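import Summits.HodgeConjecture.HodgeConjecture.Theorems.Ring2AbelianAllAndreTransportLattice
import Summits.HodgeConjecture.HodgeConjecture.Theorems.Ring2DeformPencilSpreading
import Literature.AlgebraicGeometry.Motives.MixedHodgeStructureOfPairMayerVietoris
import HarnessLib

/-!
# Ring 2, deformation axis — part XVIII: CM-spreading on complex cohomology and in the lattice of `H²ᵖ(𝒳(ℂ); ℂ)`;
the pencil branch modulo `HC_CM` alone (rev. 2: part numbers in docstrings aligned with the axis census — XIII, II-b)

HONEST FRAMING (page 1, verbatim): **research route conditional on HC_CM; not a corollary; Q11.4-sentence-2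
already refuted in dim ≥ 3.** Nothing here proves a case of the Hodge conjecture for an abelian variety. `HC_CM` =
`Theses.RankFourFaces.CMAbelianHodge` (stmt-HodgeConjecture-3052) is a BINDER wherever it occurs (§4 only); `HC_AV` =
`Theses.PadicSemiregularLift.HodgeAbelianVarieties`; item `Theses.RankFourFaces.CMToAbelian` (stmt-HodgeConjecture-16267)
OPEN and not closed here. Seat `pub-hodge-ring2-deform`, gen 42; answers the sub-cell's parts XVII-a/b (transport nodes
binder-free, `Ring2AbelianAllAndre{InvariantRationality,TransportLattice}`) for the deformation axis' OWN pencil nodes: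
CM-spreading out of ALL CM fibres — `CMSpreadingTo` (part VII), CPS_CM = `CMPointedPencilCMSpreading`, CPS_∃ =
`CMAnchoredPencilCMSpreading` (part XIII) — whose premise sits at every CM fibre at once. Notation (inline only): for a
compact pencil `f : 𝒳 ⟶ S` of abelian `d`-folds, `C_s := (j_s^*)⁻¹ N^p(𝒳_s) ⊆ H²ᵖ(𝒳(ℂ); ℂ)` (part XVII-b); a
`ℂ`-subspace `A ⊆ Hᵏ(X(ℂ); ℂ)` is RATIONALLY SPANNED when `A ⊆ span_ℂ {rational classes in A}`.

WHAT IS PROVED (theorems only; no definition, no named fact, no sorry). §1 LINEAR ALGEBRA: `inf_le_span_isRationalClass`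
— the intersection of two rationally spanned subspaces of `Hᵏ(X(ℂ); ℂ)` is rationally spanned (any `X`; flatness of `ℂ/ℚ`
via the tree's `MixedHodgeStructure.mem_baseChange_inf_ker`, through the injective `β : Hᵏ(–; ℚ) ⊗ ℂ → Hᵏ(–; ℂ)`);
`iInf_le_span_isRationalClass` — an ARBITRARY intersection, `X` smooth projective (DCC in finite dimension; the empty
intersection is universal coefficients). §2 `CMSpreadingTo f d s₁` on a CM-pointed compact pencil, binder-free:
`cmSpreadingTo_iff_rational`, **`_iff_complex`** (no rationality, no Hodge type: `⨅_{t ∈ CM} C_t` is rationally spanned),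
**`_iff_iInf_comap_le`: `⨅_{t ∈ CM} C_t ≤ C_{s₁}`**; for all `s₁`: `⨅_{t ∈ CM} C_t = ⨅_s C_s`. §3 Nodes:
**CPS_CM ⟺ `⨅_{t ∈ CM} C_t = ⨅_s C_s` on every CM-pointed compact pencil of abelian varieties**
(`cmPointedPencilCMSpreading_iff_complex/_iff_iInf_comap_eq`; part XVII-b: (1.1)_f ⟺ `s ↦ C_s` constant, (4) ⟺
`C_t ≤ C_s` at CM `t`), CPS_∃ likewise (`cmAnchoredPencilCMSpreading_iff_complex`), and the EXACT RESIDUAL of the open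
edge CPS_CM ⟹ (4): **(4) ⟺ CPS_CM ∧ [`t ↦ C_t` constant along the CM locus]** — all unconditional. §4 MODULO `HC_CM`
ALONE (no Lemme 6.3.1, not through `HC_AV`; part XIII `cmSpreadingNodes_iff_of_andre1996_of_HC_CM` needed `h₂₁`): for
ANY family with a CM fibre `HC_CM ⊢ (∀ s₁, CMSpreadingTo f n s₁) ⟺ InvariantCyclesHoldFor f n`; **`HC_CM ⊢ CPS_CM ⟺ (4)
⟺ (3)`, `CPS_∃ ⟺ (T∃)`** (`cmSpreadingNodes_iff_of_HC_CM`); `HC_CM ⊢ CPS_CM|_f ⟺ s ↦ C_s` constant; `HC_CM ⊢` the §3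
residual (CM-locus constancy of `C`).

READING (RING2-MAP §deform gen 42). On a CM-pointed compact pencil the three transport-type inputs are statements
about ONE function `s ↦ C_s`: (1.1)_f "constant", (4) "least at CM points", CPS_CM "inf over CM points = inf over all
points"; the open edges CPS_CM ⟹ (4) ⟹ (1.1)_f are "constant on the CM locus" and "least ⟹ constant". Granted `HC_CM`,
this route's standing hypothesis, all three coincide with NO further input (the sub-cell's `…AndreHodgeInvariantLattice`:
`C_s` is then the Hodge-invariant subspace `D`; COUNT ONCE for (3) ⟺ (4) mod `HC_CM`). EDGE LABELS: §1–§3 K; §4 K[HC_CM].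
References: VoisinHodgeI2002 (§7.1.1); HatcherAT2002 (§3.1); GrothendieckTopology1969 (§1); DeligneHodgeII1971 (4.1.2);
Deligne1982HodgeCycles (2.12, 2.9); Abdulali1994FamiliesAV ((1.1), 6.2); Andre1996Motifs (6.3); CharlesSchnell2014Notes (11.3).
-/

noncomputable section

set_option linter.dupNamespace false

open scoped TensorProduct

namespace Summit.HodgeConjecture.HodgeConjecture.Ring2.Deform

open CategoryTheory AlgebraicGeometry Literature.AlgebraicGeometry Literature.AlgebraicGeometry.Motives
open Literature.AlgebraicGeometry.HodgeTheory Summit.HodgeConjecture.HodgeConjecture.Theses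
open Literature.AlgebraicGeometry.Abdulali1994 (InvariantCyclesHoldFor)
open Literature.AlgebraicGeometry.Andre1996 (IsCMAnchoredPencilFor)
open Summit.HodgeConjecture.HodgeConjecture.Ring2.AbelianAll (CMPointedPencilVHC CMAnchoredTransport
  CMAnchoredPencilTransport mem_cmLocus_of_compactPencil exists_isRationalClass_map_fiberι_eq_of_fibrewiseHodge
  fibrewiseHodge_of_isRationalClass_of_mem_algebraicClasses mem_span_rational_of_map_fiberι_mem_algebraicClasses
  cmAnchoredTransport_iff_comap invariantCyclesHoldFor_iff_comap_eq)

/-! ## §1 Rationally spanned subspaces of `Hᵏ(X(ℂ); ℂ)` are closed under intersections -/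

section LinearAlgebra

variable {X : SchemeOver ℂ} {k : ℕ}

/-- **`β⁻¹ A ⊆ A_ℚ ⊗ ℂ` for a rationally spanned `A`** (`β : Hᵏ(X(ℂ); ℚ) ⊗ ℂ → Hᵏ(X(ℂ); ℂ)` injective,
`A_ℚ = {a | a ⊗ 1 ∈ A}`; the step of part XVII-b §2, isolated). [cite: VoisinHodgeI2002, §7.1.1] [cite: HatcherAT2002, §3.1] -/
theorem mem_baseChange_ratForm_of_map_mem {A : Submodule ℂ (complexBetti X k)}
    (hA : A ≤ Submodule.span ℂ {c : complexBetti X k | IsRationalClass c ∧ c ∈ A})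
    {x : ℂ ⊗[ℚ] bettiCohomology X k} (hx : ofRatClassBaseChange (ComplexPoints X) k x ∈ A) :
    x ∈ (((A.comap (ofRatClassBaseChange (ComplexPoints X) k)).restrictScalars ℚ).comap
      (HodgeStructure.ofRat (V := bettiCohomology X k))).baseChange ℂ := by
  set β := ofRatClassBaseChange (ComplexPoints X) k with hβ
  set Aℚ : Submodule ℚ (bettiCohomology X k) := ((A.comap β).restrictScalars ℚ).comap HodgeStructure.ofRat
  have hAℚ : ∀ a : bettiCohomology X k, a ∈ Aℚ ↔ ofRatClass (ComplexPoints X) k a ∈ A := fun a ↦ by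
    change β (HodgeStructure.ofRat a) ∈ A ↔ _
    rw [hβ, ofRatClassBaseChange_ofRat]
  have hle : Submodule.span ℂ {c : complexBetti X k | IsRationalClass c ∧ c ∈ A} ≤ (Aℚ.baseChange ℂ).map β := by
    refine Submodule.span_le.2 ?_
    rintro c ⟨hc, hcA⟩
    obtain ⟨a, rfl⟩ := (isRationalClass_iff_mem_range_ofRatClass c).1 hc
    refine ⟨HodgeStructure.ofRat a, ?_, by rw [hβ, ofRatClassBaseChange_ofRat]⟩
    rw [HodgeStructure.ofRat_apply]
    exact Submodule.tmul_mem_baseChange_of_mem 1 ((hAℚ a).2 hcA)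
  obtain ⟨y, hy, hyx⟩ := hle (hA hx)
  rwa [← ofRatClassBaseChange_injective _ k hyx]

/-- **`P ⊗ ℂ ∩ Q ⊗ ℂ ⊆ (P ∩ Q) ⊗ ℂ`** for `ℚ`-subspaces (flatness; `MixedHodgeStructure.mem_baseChange_inf_ker`). [folklore] -/
theorem mem_baseChange_inf_of_mem {V : Type*} [AddCommGroup V] [Module ℚ V] (P Q : Submodule ℚ V)
    {x : ℂ ⊗[ℚ] V} (hP : x ∈ P.baseChange ℂ) (hQ : x ∈ Q.baseChange ℂ) : x ∈ (P ⊓ Q).baseChange ℂ := by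
  have h := MixedHodgeStructure.mem_baseChange_inf_ker P.mkQ Q.mkQ (x := x)
    (by rw [← HodgeStructure.mem_baseChange_ker_iff, Submodule.ker_mkQ]; exact hP)
    (by rw [← HodgeStructure.mem_baseChange_ker_iff, Submodule.ker_mkQ]; exact hQ)
  simpa only [Submodule.ker_mkQ] using h

/-- **The intersection of two rationally spanned subspaces of `Hᵏ(X(ℂ); ℂ)` is rationally spanned** (any `X`):
`β⁻¹A = A_ℚ ⊗ ℂ`, `β⁻¹B = B_ℚ ⊗ ℂ`, and `A_ℚ ⊗ ℂ ∩ B_ℚ ⊗ ℂ = (A_ℚ ∩ B_ℚ) ⊗ ℂ` is spanned by `A_ℚ ∩ B_ℚ`.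
[cite: VoisinHodgeI2002, §7.1.1] [cite: HatcherAT2002, §3.1 Thm. 3.2 and p. 198] -/
theorem inf_le_span_isRationalClass {A B : Submodule ℂ (complexBetti X k)}
    (hA : A ≤ Submodule.span ℂ {c : complexBetti X k | IsRationalClass c ∧ c ∈ A})
    (hB : B ≤ Submodule.span ℂ {c : complexBetti X k | IsRationalClass c ∧ c ∈ B}) :
    A ⊓ B ≤ Submodule.span ℂ {c : complexBetti X k | IsRationalClass c ∧ c ∈ A ⊓ B} := by
  intro W hW
  set β := ofRatClassBaseChange (ComplexPoints X) k with hβ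
  obtain ⟨x, rfl⟩ : W ∈ LinearMap.range β := by
    refine Submodule.span_le.2 ?_ (hA hW.1)
    rintro c ⟨hc, -⟩
    obtain ⟨a, rfl⟩ := (isRationalClass_iff_mem_range_ofRatClass c).1 hc
    exact ⟨HodgeStructure.ofRat a, by rw [hβ, ofRatClassBaseChange_ofRat]⟩
  have hx := mem_baseChange_inf_of_mem _ _ (mem_baseChange_ratForm_of_map_mem hA hW.1)
    (mem_baseChange_ratForm_of_map_mem hB hW.2)
  rw [Submodule.baseChange_eq_span] at hx
  have hmap := Submodule.mem_map_of_mem (f := β) hx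
  rw [Submodule.map_span] at hmap
  refine Submodule.span_mono ?_ hmap
  rintro _ ⟨_, ⟨a, ⟨haA, haB⟩, rfl⟩, rfl⟩
  have haA' : β (HodgeStructure.ofRat a) ∈ A := haA
  have haB' : β (HodgeStructure.ofRat a) ∈ B := haB
  rw [hβ, ofRatClassBaseChange_ofRat] at haA' haB'
  change β ((1 : ℂ) ⊗ₜ[ℚ] a) ∈ {c : complexBetti X k | IsRationalClass c ∧ c ∈ A ⊓ B}
  rw [hβ, ofRatClassBaseChange_tmul, one_smul]
  exact ⟨isRationalClass_ofRatClass a, haA', haB'⟩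

/-- **An arbitrary intersection of rationally spanned subspaces of `Hᵏ(X(ℂ); ℂ)`, `X` smooth projective, is
rationally spanned**: `Hᵏ` is finite-dimensional (`finite_complexBetti`), so by DCC `⨅ᵢ Aᵢ` is a finite partial
intersection; then `inf_le_span_isRationalClass`, and universal coefficients for the empty one
(`span_isRationalClass_eq_top_of_isSmoothProjective`). [cite: VoisinHodgeI2002, §7.1.1] [cite: HatcherAT2002, §3.1] -/
theorem iInf_le_span_isRationalClass {n : ℕ} (hX : IsSmoothProjective n X) {ι : Sort*}
    {A : ι → Submodule ℂ (complexBetti X k)}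
    (hA : ∀ i, A i ≤ Submodule.span ℂ {c : complexBetti X k | IsRationalClass c ∧ c ∈ A i}) :
    (⨅ i, A i) ≤ Submodule.span ℂ {c : complexBetti X k | IsRationalClass c ∧ c ∈ ⨅ i, A i} := by
  classical
  haveI := finite_complexBetti hX k
  -- DCC: the infimum is a finite partial infimum
  let T : Set (Submodule ℂ (complexBetti X k)) := {x | ∃ t : Finset _, ↑t ⊆ Set.range A ∧ t.inf id = x}
  obtain ⟨t, ht, heq⟩ : ∃ t : Finset (Submodule ℂ (complexBetti X k)), ↑t ⊆ Set.range A ∧ ⨅ i, A i = t.inf id := by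
    obtain ⟨m, ⟨t, ht, rfl⟩, hm⟩ := wellFounded_lt.has_min T ⟨⊤, ∅, by simp, rfl⟩
    refine ⟨t, ht, le_antisymm (Finset.le_inf fun P hP ↦ ?_) (le_iInf fun i ↦ ?_)⟩
    · obtain ⟨i, rfl⟩ := ht hP
      exact iInf_le A i
    · have hmem : (insert (A i) t).inf id ∈ T :=
        ⟨insert (A i) t, by rw [Finset.coe_insert]; exact Set.insert_subset (Set.mem_range_self i) ht, rfl⟩
      have hle : (insert (A i) t).inf id ≤ t.inf id := Finset.inf_mono (Finset.subset_insert _ _)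
      calc t.inf id = (insert (A i) t).inf id := (eq_of_le_of_not_lt hle (hm _ hmem)).symm
        _ ≤ id (A i) := Finset.inf_le (Finset.mem_insert_self _ _)
  rw [heq]
  -- finite intersections, by induction
  have key : ∀ u : Finset (Submodule ℂ (complexBetti X k)), ↑u ⊆ Set.range A →
      u.inf id ≤ Submodule.span ℂ {c : complexBetti X k | IsRationalClass c ∧ c ∈ u.inf id} := by
    intro u
    induction u using Finset.induction_on with
    | empty =>
      intro _
      rw [Finset.inf_empty]
      intro W _
      have hW : W ∈ Submodule.span ℂ {c : complexBetti X k | IsRationalClass c} := by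
        rw [span_isRationalClass_eq_top_of_isSmoothProjective_holds n X hX k]; trivial
      refine Submodule.span_mono ?_ hW
      exact fun c hc ↦ ⟨hc, Submodule.mem_top⟩
    | insert P u hP ih =>
      intro hu
      rw [Finset.coe_insert] at hu
      obtain ⟨i, hi⟩ := hu (Set.mem_insert P _)
      have hu' : ↑u ⊆ Set.range A := fun Q hQ ↦ hu (Set.mem_insert_of_mem P hQ)
      rw [Finset.inf_insert, id, ← hi]
      exact inf_le_span_isRationalClass (hA i) (ih hu')
  exact key t ht

end LinearAlgebra

variable {𝒳 S : SchemeOver ℂ}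

/-! ## §2 `CMSpreadingTo` on a CM-pointed compact pencil, binder-free -/

/-- **`CMSpreadingTo f d s₁` without its Hodge binder** (compact pencil of abelian `d`-folds with a CM fibre): every
RATIONAL `W ∈ H²ᵖ(𝒳(ℂ); ℂ)` algebraic on all CM fibres has `j_{s₁}^* W` algebraic (algebraic on a fibre ⟹ fibrewise
Hodge, part XVII-a; "⟹" uses the CM fibre). [cite: Deligne1982HodgeCycles, Thm. 2.12, Prop. 2.9] [cite: DeligneHodgeII1971, Cor. 4.1.2] -/
theorem cmSpreadingTo_iff_rational {d : ℕ} {f : 𝒳 ⟶ S} (hf : IsCompactAbelianPencil f d)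
    (hne : (cmLocus f d).Nonempty) (s₁ : ComplexPoints S) :
    CMSpreadingTo f d s₁ ↔ ∀ (p : ℕ) (W : complexBetti 𝒳 (2 * p)), IsRationalClass W →
      (∀ t ∈ cmLocus f d, complexBetti.map (fiberι f t) (2 * p) W ∈ algebraicClasses (fiberOver f t) p) →
      complexBetti.map (fiberι f s₁) (2 * p) W ∈ algebraicClasses (fiberOver f s₁) p := by
  refine ⟨fun h p W hW hcm ↦ ?_, fun h p W hW hcm ↦ ?_⟩
  · obtain ⟨t, ht⟩ := hne
    exact h p W (fibrewiseHodge_of_isRationalClass_of_mem_algebraicClasses hf hW (hcm t ht)) hcm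
  · obtain ⟨W₀, hW₀, hW₀s⟩ := exists_isRationalClass_map_fiberι_eq_of_fibrewiseHodge hf W hW s₁
    rw [← hW₀s s₁]
    exact h p W₀ hW₀ fun t ht ↦ by rw [hW₀s t]; exact hcm t ht

/-- **`⨅_{t ∈ CM} C_t` is rationally spanned** (§1 over the CM points; each `C_t` is rationally spanned, part XVII-b
`mem_span_rational_of_map_fiberι_mem_algebraicClasses`). [cite: GrothendieckTopology1969, §1] [cite: VoisinHodgeI2002, §7.1.1] -/
theorem iInf_cmLocus_comap_le_span_isRationalClass {d : ℕ} {f : 𝒳 ⟶ S} (hf : IsCompactAbelianPencil f d) (p : ℕ) :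
    (⨅ t ∈ cmLocus f d, (algebraicClasses (fiberOver f t) p).comap (complexBetti.map (fiberι f t) (2 * p)).hom) ≤
      Submodule.span ℂ {c : complexBetti 𝒳 (2 * p) | IsRationalClass c ∧
        c ∈ ⨅ t ∈ cmLocus f d, (algebraicClasses (fiberOver f t) p).comap (complexBetti.map (fiberι f t) (2 * p)).hom} :=
  iInf_le_span_isRationalClass hf.isSmoothProjective_total
    (A := fun t : ComplexPoints S ↦ ⨅ (_ : t ∈ cmLocus f d),
      (algebraicClasses (fiberOver f t) p).comap (complexBetti.map (fiberι f t) (2 * p)).hom)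
    fun t ↦ iInf_le_span_isRationalClass hf.isSmoothProjective_total
      (A := fun _ : t ∈ cmLocus f d ↦
        (algebraicClasses (fiberOver f t) p).comap (complexBetti.map (fiberι f t) (2 * p)).hom)
      fun _ W (hW : complexBetti.map (fiberι f t) (2 * p) W ∈ algebraicClasses (fiberOver f t) p) ↦
        mem_span_rational_of_map_fiberι_mem_algebraicClasses hf (t := t) (p := p) (W := W) hW

/-- **`CMSpreadingTo f d s₁` on COMPLEX cohomology** (no rationality, no Hodge type): EVERY `W ∈ H²ᵖ(𝒳(ℂ); ℂ)` with
`j_t^* W ∈ N^p(𝒳_t)` at all CM points `t` has `j_{s₁}^* W ∈ N^p(𝒳_{s₁})` (such `W` is a `ℂ`-combination of RATIONAL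
ones, `iInf_cmLocus_comap_le_span_isRationalClass`). [cite: Deligne1982HodgeCycles, Thm. 2.12] [cite: GrothendieckTopology1969, §1] -/
theorem cmSpreadingTo_iff_complex {d : ℕ} {f : 𝒳 ⟶ S} (hf : IsCompactAbelianPencil f d)
    (hne : (cmLocus f d).Nonempty) (s₁ : ComplexPoints S) :
    CMSpreadingTo f d s₁ ↔ ∀ (p : ℕ) (W : complexBetti 𝒳 (2 * p)),
      (∀ t ∈ cmLocus f d, complexBetti.map (fiberι f t) (2 * p) W ∈ algebraicClasses (fiberOver f t) p) →
      complexBetti.map (fiberι f s₁) (2 * p) W ∈ algebraicClasses (fiberOver f s₁) p := by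
  rw [cmSpreadingTo_iff_rational hf hne s₁]
  refine ⟨fun h p W hcm ↦ ?_, fun h p W _ hcm ↦ h p W hcm⟩
  have hWmem : W ∈ ⨅ t ∈ cmLocus f d,
      (algebraicClasses (fiberOver f t) p).comap (complexBetti.map (fiberι f t) (2 * p)).hom :=
    (Submodule.mem_iInf _).2 fun t ↦ (Submodule.mem_iInf _).2 fun ht ↦ hcm t ht
  refine (Submodule.span_le (p := (algebraicClasses (fiberOver f s₁) p).comap
      (complexBetti.map (fiberι f s₁) (2 * p)).hom)).2 ?_ (iInf_cmLocus_comap_le_span_isRationalClass hf p hWmem)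
  rintro W' ⟨hW', hW'mem⟩
  exact h p W' hW' fun t ht ↦ (Submodule.mem_iInf _).1 ((Submodule.mem_iInf _).1 hW'mem t) ht

/-- **`CMSpreadingTo f d s₁` in lattice form: `⨅_{t ∈ CM} C_t ≤ C_{s₁}`**, every `p`. [cite: Abdulali1994FamiliesAV, Lemma 6.2] -/
theorem cmSpreadingTo_iff_iInf_comap_le {d : ℕ} {f : 𝒳 ⟶ S} (hf : IsCompactAbelianPencil f d)
    (hne : (cmLocus f d).Nonempty) (s₁ : ComplexPoints S) :
    CMSpreadingTo f d s₁ ↔ ∀ p : ℕ,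
      (⨅ t ∈ cmLocus f d, (algebraicClasses (fiberOver f t) p).comap (complexBetti.map (fiberι f t) (2 * p)).hom) ≤
        (algebraicClasses (fiberOver f s₁) p).comap (complexBetti.map (fiberι f s₁) (2 * p)).hom := by
  rw [cmSpreadingTo_iff_complex hf hne s₁]
  refine ⟨fun h p W hW ↦ h p W fun t ht ↦ (Submodule.mem_iInf _).1 ((Submodule.mem_iInf _).1 hW t) ht,
    fun h p W hcm ↦ h p ((Submodule.mem_iInf _).2 fun t ↦ (Submodule.mem_iInf _).2 fun ht ↦ hcm t ht)⟩

/-- **CM-spreading to EVERY fibre, on complex cohomology.** [cite: Deligne1982HodgeCycles, Thm. 2.12 and Prop. 2.9] -/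
theorem forall_cmSpreadingTo_iff_complex {d : ℕ} {f : 𝒳 ⟶ S} (hf : IsCompactAbelianPencil f d)
    (hne : (cmLocus f d).Nonempty) :
    (∀ s₁ : ComplexPoints S, CMSpreadingTo f d s₁) ↔ ∀ (p : ℕ) (W : complexBetti 𝒳 (2 * p)),
      (∀ t ∈ cmLocus f d, complexBetti.map (fiberι f t) (2 * p) W ∈ algebraicClasses (fiberOver f t) p) →
      ∀ s : ComplexPoints S, complexBetti.map (fiberι f s) (2 * p) W ∈ algebraicClasses (fiberOver f s) p :=
  ⟨fun h p W hcm s ↦ (cmSpreadingTo_iff_complex hf hne s).1 (h s) p W hcm,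
    fun h s ↦ (cmSpreadingTo_iff_complex hf hne s).2 fun p W hcm ↦ h p W hcm s⟩

/-- **CM-spreading to EVERY fibre, in lattice form: `⨅_{t ∈ CM} C_t = ⨅_{s} C_s`.** [cite: Abdulali1994FamiliesAV, (1.1), Lemma 6.2] -/
theorem forall_cmSpreadingTo_iff_iInf_comap_eq {d : ℕ} {f : 𝒳 ⟶ S} (hf : IsCompactAbelianPencil f d)
    (hne : (cmLocus f d).Nonempty) :
    (∀ s₁ : ComplexPoints S, CMSpreadingTo f d s₁) ↔ ∀ p : ℕ,
      (⨅ t ∈ cmLocus f d, (algebraicClasses (fiberOver f t) p).comap (complexBetti.map (fiberι f t) (2 * p)).hom) =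
        ⨅ s : ComplexPoints S, (algebraicClasses (fiberOver f s) p).comap (complexBetti.map (fiberι f s) (2 * p)).hom := by
  refine ⟨fun h p ↦ le_antisymm (le_iInf fun s ↦ (cmSpreadingTo_iff_iInf_comap_le hf hne s).1 (h s) p)
      (le_iInf₂ fun t _ ↦ iInf_le _ t), fun h s ↦ (cmSpreadingTo_iff_iInf_comap_le hf hne s).2 fun p ↦ ?_⟩
  rw [h p]
  exact iInf_le _ s

/-! ## §3 The nodes CPS_CM and CPS_∃ binder-free, and the exact residual of CPS_CM ⟹ (4) -/

/-- **CPS_CM on complex cohomology** (no rationality, no Hodge type): on every CM-pointed compact pencil of abelian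
varieties, a complex global class algebraic on all CM fibres is algebraic on all fibres. [cite: Andre1996Motifs, §6.3 (p. 33)] -/
theorem cmPointedPencilCMSpreading_iff_complex :
    CMPointedPencilCMSpreading ↔ ∀ ⦃d : ℕ⦄ ⦃𝒳 S : SchemeOver ℂ⦄ (f : 𝒳 ⟶ S), IsCompactAbelianPencil f d →
      (cmLocus f d).Nonempty → ∀ (p : ℕ) (W : complexBetti 𝒳 (2 * p)),
        (∀ t ∈ cmLocus f d, complexBetti.map (fiberι f t) (2 * p) W ∈ algebraicClasses (fiberOver f t) p) →
        ∀ s : ComplexPoints S, complexBetti.map (fiberι f s) (2 * p) W ∈ algebraicClasses (fiberOver f s) p :=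
  ⟨fun h _ _ _ f hf hne ↦ (forall_cmSpreadingTo_iff_complex hf hne).1 (h f hf hne),
    fun h _ _ _ f hf hne ↦ (forall_cmSpreadingTo_iff_complex hf hne).2 (h f hf hne)⟩

/-- **CPS_CM in lattice form: `⨅_{t ∈ CM} C_t = ⨅_{s} C_s`** on every CM-pointed compact pencil of abelian varieties
(part XVII-b: (1.1)_f ⟺ `s ↦ C_s` constant; (4) ⟺ `C_t ≤ C_s` for CM `t`).
[cite: Andre1996Motifs, §6.3 Remarque 2 (p. 33)] [cite: Abdulali1994FamiliesAV, (1.1) and Lemma 6.2] -/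
theorem cmPointedPencilCMSpreading_iff_iInf_comap_eq :
    CMPointedPencilCMSpreading ↔ ∀ ⦃d : ℕ⦄ ⦃𝒳 S : SchemeOver ℂ⦄ (f : 𝒳 ⟶ S), IsCompactAbelianPencil f d →
      (cmLocus f d).Nonempty → ∀ p : ℕ,
        (⨅ t ∈ cmLocus f d, (algebraicClasses (fiberOver f t) p).comap (complexBetti.map (fiberι f t) (2 * p)).hom) =
          ⨅ s : ComplexPoints S,
            (algebraicClasses (fiberOver f s) p).comap (complexBetti.map (fiberι f s) (2 * p)).hom :=
  ⟨fun h _ _ _ f hf hne ↦ (forall_cmSpreadingTo_iff_iInf_comap_eq hf hne).1 (h f hf hne),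
    fun h _ _ _ f hf hne ↦ (forall_cmSpreadingTo_iff_iInf_comap_eq hf hne).2 (h f hf hne)⟩

/-- The 6.3.1 pencil has a nonempty CM locus (clause (ii)). [cite: Andre1996Motifs, Lemme 6.3.1 (ii) (p. 31)] -/
theorem cmLocus_nonempty_of_isCMAnchoredPencilFor {A : AbelianVariety ℂ} {p : ℕ} {c : complexBetti A.X (2 * p)}
    {f : 𝒳 ⟶ S} (h : IsCMAnchoredPencilFor A p c f) : (cmLocus f (2 * A.dim)).Nonempty := by
  obtain ⟨hf, _, t, _, _, A₀, _, _, _, _, _, _, ⟨e₀⟩, hA₀⟩ := h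
  exact ⟨t, mem_cmLocus_of_compactPencil hf e₀ hA₀⟩

/-- **CPS_∃ on complex cohomology**: through every Hodge class `(A, p, c)` a 6.3.1 pencil along which EVERY complex
global class algebraic on all CM fibres is algebraic on all fibres. [cite: Andre1996Motifs, Lemme 6.3.1 (p. 31)] -/
theorem cmAnchoredPencilCMSpreading_iff_complex :
    CMAnchoredPencilCMSpreading ↔ ∀ (A : AbelianVariety ℂ), IsSmoothProjective A.dim A.X →
      ∀ (p : ℕ) (c : complexBetti A.X (2 * p)), IsRationalClass c → IsOfHodgeType A.dim A.X (2 * p) p p c →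
        ∃ (𝒳 S : SchemeOver ℂ) (f : 𝒳 ⟶ S), IsCMAnchoredPencilFor A p c f ∧
          ∀ (p' : ℕ) (W : complexBetti 𝒳 (2 * p')),
            (∀ t ∈ cmLocus f (2 * A.dim),
              complexBetti.map (fiberι f t) (2 * p') W ∈ algebraicClasses (fiberOver f t) p') →
            ∀ s : ComplexPoints S, complexBetti.map (fiberι f s) (2 * p') W ∈ algebraicClasses (fiberOver f s) p' := by
  refine forall₂_congr fun A _ ↦ forall₂_congr fun p c ↦ forall₂_congr fun _ _ ↦ ?_
  refine exists₃_congr fun 𝒳 S f ↦ and_congr_right fun hanch ↦ ?_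
  exact forall_cmSpreadingTo_iff_complex hanch.1 (cmLocus_nonempty_of_isCMAnchoredPencilFor hanch)

/-- **The exact residual of the open edge CPS_CM ⟹ (4): (4) ⟺ CPS_CM ∧ [`t ↦ C_t` CONSTANT ALONG THE CM LOCUS of
every compact pencil of abelian varieties]** ((4): each CM `C_t` is the least `C_s`; CPS_CM: the inf of the CM `C_t` is
the least `C_s`; `HC_CM` supplies the constancy, §4; open otherwise). [cite: Andre1996Motifs, §6.3 a), Remarque 2 (p. 33)] -/
theorem cmAnchoredTransport_iff_cmPointedPencilCMSpreading_and_cmLocus_constant :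
    CMAnchoredTransport ↔ CMPointedPencilCMSpreading ∧
      ∀ ⦃d : ℕ⦄ ⦃𝒳 S : SchemeOver ℂ⦄ (f : 𝒳 ⟶ S), IsCompactAbelianPencil f d → ∀ (p : ℕ),
        ∀ t ∈ cmLocus f d, ∀ t' ∈ cmLocus f d,
          (algebraicClasses (fiberOver f t) p).comap (complexBetti.map (fiberι f t) (2 * p)).hom =
            (algebraicClasses (fiberOver f t') p).comap (complexBetti.map (fiberι f t') (2 * p)).hom := by
  rw [cmAnchoredTransport_iff_comap, cmPointedPencilCMSpreading_iff_iInf_comap_eq]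
  refine ⟨fun h ↦ ⟨fun d 𝒳 S f hf hne p ↦ le_antisymm (le_iInf fun s ↦ ?_) (le_iInf₂ fun t _ ↦ iInf_le _ t),
      fun d 𝒳 S f hf p t ht t' ht' ↦ le_antisymm (h f hf p t ht t') (h f hf p t' ht' t)⟩,
    fun ⟨hS, hK⟩ d 𝒳 S f hf p t ht s ↦ ?_⟩
  · obtain ⟨t, ht⟩ := hne
    exact (iInf₂_le t ht).trans (h f hf p t ht s)
  · have hinf : (⨅ t' ∈ cmLocus f d,
        (algebraicClasses (fiberOver f t') p).comap (complexBetti.map (fiberι f t') (2 * p)).hom) =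
        (algebraicClasses (fiberOver f t) p).comap (complexBetti.map (fiberι f t) (2 * p)).hom :=
      le_antisymm (iInf₂_le t ht) (le_iInf₂ fun t' ht' ↦ (hK f hf p t ht t' ht').le)
    rw [← hinf, hS f hf ⟨t, ht⟩ p]
    exact iInf_le _ s

/-! ## §4 The pencil branch modulo `HC_CM` alone (no Lemme 6.3.1; not through `HC_AV`) -/

/-- **Per family, `HC_CM ⊢` CM-spreading to every fibre ⟺ (1.1)_f** (ANY `f` with a CM fibre, no compactness): under
`HC_CM` a fibrewise-Hodge class is algebraic on every CM fibre (part II-b `forall_cmLocus_mem_algebraicClasses_of_HC_CM`);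
conversely part VII. [cite: Abdulali1994FamiliesAV, (1.1), Lemma 6.2 (p. 1131)] [cite: Deligne1982HodgeCycles, Thm. 2.12] -/
theorem forall_cmSpreadingTo_iff_invariantCyclesHoldFor_of_HC_CM (hCM : RankFourFaces.CMAbelianHodge)
    {f : 𝒳 ⟶ S} {n : ℕ} (hne : (cmLocus f n).Nonempty) :
    (∀ s₁ : ComplexPoints S, CMSpreadingTo f n s₁) ↔ InvariantCyclesHoldFor f n :=
  ⟨fun h p W hW _ s ↦ h s p W hW (forall_cmLocus_mem_algebraicClasses_of_HC_CM hCM f W hW),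
    fun h ↦ cmSpreadingTo_of_invariantCyclesHoldFor h hne⟩

/-- **Per CM-pointed compact pencil, `HC_CM ⊢` CM-spreading to every fibre ⟺ `s ↦ C_s` CONSTANT** (part XVII-b's
lattice; the sub-cell's `…AndreHodgeInvariantLattice` names the constant: the Hodge-invariant subspace `D`).
[cite: Abdulali1994FamiliesAV, (1.1) (p. 1122)] [cite: CharlesSchnell2014Notes, (11.3.1)] -/
theorem forall_cmSpreadingTo_iff_comap_eq_of_HC_CM (hCM : RankFourFaces.CMAbelianHodge) {d : ℕ} {f : 𝒳 ⟶ S}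
    (hf : IsCompactAbelianPencil f d) (hne : (cmLocus f d).Nonempty) :
    (∀ s₁ : ComplexPoints S, CMSpreadingTo f d s₁) ↔ ∀ (p : ℕ) (s s' : ComplexPoints S),
      (algebraicClasses (fiberOver f s) p).comap (complexBetti.map (fiberι f s) (2 * p)).hom =
        (algebraicClasses (fiberOver f s') p).comap (complexBetti.map (fiberι f s') (2 * p)).hom :=
  (forall_cmSpreadingTo_iff_invariantCyclesHoldFor_of_HC_CM hCM hne).trans (invariantCyclesHoldFor_iff_comap_eq hf)

/-- **`HC_CM ⊢ CPS_CM ⟺ (3)** (`CMPointedCompactPencilVHC`; the sub-cell's (3) by part XIII); NO named fact. [cite: Andre1996Motifs, §6.3] -/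
theorem cmPointedPencilCMSpreading_iff_cmPointedCompactPencilVHC_of_HC_CM (hCM : RankFourFaces.CMAbelianHodge) :
    CMPointedPencilCMSpreading ↔ CMPointedCompactPencilVHC :=
  ⟨fun h _ _ _ f hf hpt ↦ (forall_cmSpreadingTo_iff_invariantCyclesHoldFor_of_HC_CM hCM
      ((cmLocus_nonempty_iff_cmPointed hf).2 hpt)).1 (h f hf ((cmLocus_nonempty_iff_cmPointed hf).2 hpt)),
    cmPointedPencilCMSpreading_of_cmPointedCompactPencilVHC⟩

/-- **`HC_CM ⊢ CPS_CM ⟺ (4)** (`CMAnchoredTransport`) — NO named fact: under `HC_CM` a fibrewise-Hodge class is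
algebraic on ALL CM fibres, so transport out of one CM fibre is CM-spreading. [cite: Andre1996Motifs, §6.3 a) (p. 33)] -/
theorem cmPointedPencilCMSpreading_iff_cmAnchoredTransport_of_HC_CM (hCM : RankFourFaces.CMAbelianHodge) :
    CMPointedPencilCMSpreading ↔ CMAnchoredTransport :=
  ⟨fun h _ _ _ f hf p W hW t ht _ s ↦
      h f hf ⟨t, ht⟩ s p W hW (forall_cmLocus_mem_algebraicClasses_of_HC_CM hCM f W hW),
    cmPointedPencilCMSpreading_of_cmAnchoredTransport⟩

/-- **`HC_CM ⊢ CPS_∃ ⟺ (T∃)** (`CMAnchoredPencilTransport`); NO named fact (same pencil). [cite: Andre1996Motifs, Lemme 6.3.1] -/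
theorem cmAnchoredPencilCMSpreading_iff_cmAnchoredPencilTransport_of_HC_CM (hCM : RankFourFaces.CMAbelianHodge) :
    CMAnchoredPencilCMSpreading ↔ CMAnchoredPencilTransport := by
  refine ⟨fun h A hA p c hc hpp ↦ ?_, cmAnchoredPencilCMSpreading_of_cmAnchoredPencilTransport⟩
  obtain ⟨𝒳, S, f, hanch, hsp⟩ := h A hA p c hc hpp
  exact ⟨𝒳, S, f, hanch, fun p' W hW t _ _ s ↦
    hsp s p' W hW (forall_cmLocus_mem_algebraicClasses_of_HC_CM hCM f W hW)⟩

/-- **The pencil branch collapses modulo `HC_CM` ALONE**: `CPS_CM ⟺ (4) ⟺ (3)`, `CPS_∃ ⟺ (T∃)`, `CPS_∃ ⟹ CPS_CM` —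
part XIII `cmSpreadingNodes_iff_of_andre1996_of_HC_CM` with the binder `h₂₁` (Lemme 6.3.1) DELETED (only CPS_CM ⟹ CPS_∃
still wants the 6.3.1 pencils). [cite: Andre1996Motifs, §6.3 (pp. 31–33)] [cite: Abdulali1994FamiliesAV, (1.1), Lemma 6.2] -/
theorem cmSpreadingNodes_iff_of_HC_CM (hCM : RankFourFaces.CMAbelianHodge) :
    (CMPointedPencilCMSpreading ↔ CMAnchoredTransport) ∧ (CMPointedPencilCMSpreading ↔ CMPointedCompactPencilVHC) ∧
      (CMAnchoredPencilCMSpreading ↔ CMAnchoredPencilTransport) ∧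
      (CMAnchoredPencilCMSpreading → CMPointedPencilCMSpreading) :=
  ⟨cmPointedPencilCMSpreading_iff_cmAnchoredTransport_of_HC_CM hCM,
    cmPointedPencilCMSpreading_iff_cmPointedCompactPencilVHC_of_HC_CM hCM,
    cmAnchoredPencilCMSpreading_iff_cmAnchoredPencilTransport_of_HC_CM hCM,
    fun h ↦ cmPointedPencilCMSpreading_of_HC_AV (HC_AV_of_HC_CM_of_cmAnchoredPencilCMSpreading hCM h)⟩

/-- **Modulo `HC_CM`, `t ↦ C_t` is constant along the CM locus** of every compact pencil of abelian varieties (the §3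
residual, discharged): a class algebraic on the CM fibre `𝒳_t` is a `ℂ`-combination of RATIONAL such (part XVII-b),
fibrewise Hodge (XVII-a), hence algebraic on the CM fibre `𝒳_{t'}` (part II-b). [cite: Deligne1982HodgeCycles, Thm. 2.12] -/
theorem comap_algebraicClasses_eq_of_mem_cmLocus_of_HC_CM (hCM : RankFourFaces.CMAbelianHodge) {d : ℕ} {f : 𝒳 ⟶ S}
    (hf : IsCompactAbelianPencil f d) (p : ℕ) {t t' : ComplexPoints S} (ht : t ∈ cmLocus f d)
    (ht' : t' ∈ cmLocus f d) :
    (algebraicClasses (fiberOver f t) p).comap (complexBetti.map (fiberι f t) (2 * p)).hom =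
      (algebraicClasses (fiberOver f t') p).comap (complexBetti.map (fiberι f t') (2 * p)).hom := by
  have key : ∀ u u' : ComplexPoints S, u' ∈ cmLocus f d →
      (algebraicClasses (fiberOver f u) p).comap (complexBetti.map (fiberι f u) (2 * p)).hom ≤
        (algebraicClasses (fiberOver f u') p).comap (complexBetti.map (fiberι f u') (2 * p)).hom := by
    intro u u' hu' W (hW : complexBetti.map (fiberι f u) (2 * p) W ∈ algebraicClasses (fiberOver f u) p)
    refine (Submodule.span_le (p := (algebraicClasses (fiberOver f u') p).comap
      (complexBetti.map (fiberι f u') (2 * p)).hom)).2 ?_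
      (mem_span_rational_of_map_fiberι_mem_algebraicClasses hf (t := u) (p := p) (W := W) hW)
    rintro W' ⟨hW', hW'u⟩
    exact forall_cmLocus_mem_algebraicClasses_of_HC_CM hCM f W'
      (fibrewiseHodge_of_isRationalClass_of_mem_algebraicClasses hf hW' hW'u) u' hu'
  exact le_antisymm (key t t' ht') (key t' t ht)

end Summit.HodgeConjecture.HodgeConjecture.Ring2.Deform
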